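import Literature.AlgebraicGeometry.Modules.SerreTwistHyperplaneClass
import Literature.AlgebraicGeometry.Modules.SerreTwistMonomialSections
import Literature.AlgebraicGeometry.Modules.SerreTwistHom
import Literature.AlgebraicGeometry.Motives.GeneratingSectionsFrameIndependence
import Literature.AlgebraicGeometry.Motives.GeneratingSectionsOfCocycleComap
import Literature.AlgebraicGeometry.Morphisms.ProjectiveSpaceOverBasePoints
import HarnessLib

/-!
# The morphism to `𝐏ʳ` defined by `𝒪_Z(1)` and its coordinate sections, read in any frame, is the embedding itself
# (Hartshorne II Thm. 7.1 (a)+(b) for an embedded scheme, in the Serre-twist model)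

Layer `Literature/AlgebraicGeometry/Modules`, namespace `Literature.AlgebraicGeometry.Modules.SerreTwist`.  ONE definition with
body (`chartSections`, the coefficient datum of the homogeneous coordinates in the standard charts — plumbing) + theorems; no
instance, no notation, no named fact, no `sorry`.  Cell `hodgecm-mathlib` (D-0151), F-DAG F-6 (H-rep) brick (R-L) (L1) (B-plan1 (g17)
09:48:04Z; censuses `B-provers/B-p18/g19/CENSUS-F6-HRep-SiegelFramedCovariantOfHilb.B-p18g19.md` and the (R3) hand of B-p17 (g13)
`AbelianSchemes/MFKUniversalLinearRigidification`, which binds the head (L1) by name).  Count-neutral Mathlib-side capital: HC_CM is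
proved only modulo the 7 printed citations until rung 0 closes — nothing here bears on a summit statement.

For a morphism `ι : Z → 𝐏ʳ_A` (★ `ProjCech.PP`), [Hartshorne1977] II Thm. 7.1 (a) says that `ι^*𝒪(1)` is generated by the global
sections `x₀|_Z, …, x_r|_Z` and (b) that the morphism they define is `ι`.  The tree reads morphisms to projective space through the
sheaf-free data ★ `GeneratingSections` («opens `Z_{s_i}` + ratios `s_j/s_i`»): `GeneratingSections.ofHom ι` (opens `ι⁻¹D₊(x_i)`, ratios
`ι^*(x_j/x_i)`) with ★ `toProj_ofHom : (ofHom ι).toProj = ι`; and it reads «the morphism defined by a line bundle `E` with sections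
`t_i`» as `ofCocycleSections F.U (CocycleSections.ofFrameSystem F h t)` for a rank-one frame system `F` of `E` (★
`Motives/GeneratingSectionsOfLineBundle`, frame-independent by ★ `Motives/GeneratingSectionsFrameIndependence`).  This file identifies
the two for `E := 𝒪_Z(1) = SerreTwist.twistMod ι 𝒪_Z 1` (★ `Modules/SerreTwistMod`) and `t_i := x_i|_Z` (★ `SerreTwist.monomialSection`):

* §1 `chartSections ι` — the coefficient datum `c_i(a) = x_i/x_a ∈ Γ(Z, Z_a)` (★ `SerreTwist.chartFun`) on the standard charts
  `Z_a = ι⁻¹D₊(x_a)`; **`ofCocycleSections_chartSections_eq_ofHom`** — its generating-sections datum IS `GeneratingSections.ofHom ι`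
  (the dictionary ★ `map_homRatio_eq_map_chartFun`, ★ `Zop_singleton_eq_preU`); hence `toProj_chartSections : (…).toProj = ι`.
* §2 for ANY rank-one frame system `F` of `𝒪_Z(1)`: `map_monomialSection_eq_chartFun_smul` (`x_i|_{Z_a} = (x_i/x_a) · x_a|_{Z_a}`),
  `eq_comp_smul_monomialSection` (every section over `V ⊆ Z_a` is a multiple of `x_a`), `isUnit_map_coeffAt_monomialSection`
  (the coefficient of `x_a` in any local frame is a unit on `U_x ∩ Z_a`), `map_coeffAt_monomialSection_eq_mul` (change of
  trivialisation), and **`ofCocycleSections_ofFrameSystem_monomialSection_eq`** (★ `ofCocycleSections_eq_of_rescale`): the frame datum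
  equals the chart datum; hence the HEAD **`toProj_ofFrameSystem_monomialSection_one`**: `(ofCocycleSections F.U (ofFrameSystem F h1
  (fun i => monomialSection ι 1 (fun _ => i))) _).toProj (strZ ι) = ι`.

## References
* [Hartshorne1977] R. Hartshorne, *Algebraic Geometry* (1977), II Thm. 7.1 (a), (b) (p. 150); II Prop. 5.12 (p. 117).
* [MumfordFogartyKirwan1994] D. Mumford, J. Fogarty, F. Kirwan, *Geometric Invariant Theory*, 3rd ed. (1994), Ch. 7 §2 Def. 7.5
  (p. 130) (linear rigidifications read through the embedding they define).
-/

noncomputable section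

-- `TopCat.Presheaf`/`Scheme.Modules` are not reducible (as in Mathlib's `AlgebraicGeometry/Modules/Sheaf.lean`).
set_option backward.isDefEq.respectTransparency false

universe u

open CategoryTheory AlgebraicGeometry TopologicalSpace Opposite
open Literature.AlgebraicGeometry.Morphisms Literature.AlgebraicGeometry.Morphisms.ProjCech
open Literature.AlgebraicGeometry.Motives Literature.AlgebraicGeometry.Motives.GeneratingSections

attribute [local instance] MvPolynomial.gradedAlgebra
  Literature.AlgebraicGeometry.Motives.ProjBaseChange.algebraBase

namespace Literature.AlgebraicGeometry.Modules

namespace SerreTwist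

variable {A : Type u} [CommRing A] {r : ℕ} {Z : Scheme.{u}} (ι : Z ⟶ PP A r)

/-! ## §1 The chart datum of the homogeneous coordinates and `GeneratingSections.ofHom ι` -/

/-- Two-step restriction of `𝒪_Z` equals any one-step restriction with the same ends. [folklore] -/
private theorem res_res {U V W : Z.Opens} (p : op U ⟶ op V) (q : op V ⟶ op W) (s : Γ(Z, U)) :
    Z.presheaf.map q (Z.presheaf.map p s) = Z.presheaf.map (p ≫ q) s := by
  rw [← CommRingCat.comp_apply, ← Functor.map_comp]

/-- **`x_i/x_a` is `ι^*(x_i/x_a)`** transported along `Z_{{a}} = ι⁻¹D₊(x_a)`: the chart function of the Serre twists IS the ratio of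
`GeneratingSections.ofHom ι` (★ `map_homRatio_eq_map_chartFun` on the whole chart). [cite: Hartshorne1977, II Thm. 7.1 (a) (p. 150)] -/
theorem chartFun_eq_map_homRatio (i a : Fin (r + 1)) :
    chartFun ι i a = Z.presheaf.map (homOfLE (Zop_singleton_eq_preU ι a).le).op (homRatio ι a i) := by
  have h := map_homRatio_eq_map_chartFun ι a i (V := Zop ι {a}) (Zop_singleton_eq_preU ι a).le le_rfl
  rw [h]
  have : (homOfLE (le_rfl : Zop ι {a} ≤ Zop ι {a})).op = 𝟙 _ := Subsingleton.elim _ _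
  rw [this, CategoryTheory.Functor.map_id]; rfl

/-- The non-vanishing locus of `x_i/x_a` on `Z_a` is `Z_a ∩ Z_i`. [cite: Hartshorne1977, II Thm. 7.1 (a) (p. 150)] -/
theorem basicOpen_chartFun (i a : Fin (r + 1)) : Z.basicOpen (chartFun ι i a) = Zop ι {a} ⊓ Zop ι {i} := by
  rw [chartFun_eq_map_homRatio, Scheme.basicOpen_res, basicOpen_homRatio, Zop_singleton_eq_preU,
    Zop_singleton_eq_preU, ← inf_assoc, inf_idem]

/-- **The chart datum of the homogeneous coordinates**: on the standard charts `Z_a = ι⁻¹D₊(x_a)` the coefficient of `x_i` is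
`x_i/x_a` (★ `SerreTwist.chartFun`); cross-compatibility is the cocycle identity `x_i/x_b · x_j/x_a = x_j/x_b · x_i/x_a`, locus
compatibility is `Z_a ∩ Z_i ∩ Z_b ⊆ Z_b ∩ Z_i` (plumbing definition). [cite: Hartshorne1977, II proof of Thm. 7.1 (p. 150)] -/
def chartSections : CocycleSections (Fin (r + 1)) (fun a : Fin (r + 1) => Zop ι {a}) where
  coeff i a := chartFun ι i a
  cross i j a b := by
    rw [chartFun_cocycle ι i b a inf_le_right inf_le_left, chartFun_cocycle ι j b a inf_le_right inf_le_left]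
    ring
  locus i a b := by
    rw [basicOpen_chartFun, basicOpen_chartFun]
    exact le_inf inf_le_right (inf_le_left.trans inf_le_right)

/-- The coefficients of the chart datum are the chart functions (`rfl`). [cite: Hartshorne1977, II proof of Thm. 7.1 (p. 150)] -/
@[simp] theorem chartSections_coeff (i a : Fin (r + 1)) : (chartSections ι).coeff i a = chartFun ι i a := rfl

/-- The standard charts cover `Z`. [folklore] -/
private theorem iSup_Zop_singleton_eq_top : ⨆ a : Fin (r + 1), Zop ι {a} = ⊤ :=
  top_le_iff.mp ((le_iSup_inf_Zop ι ⊤).trans (iSup_mono fun _ => inf_le_right))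

/-- The non-vanishing loci of the chart datum cover `Z` (already the `a = i` pieces `Z_i` do). [cite: Hartshorne1977, II Thm. 7.1 (a) (p. 150)] -/
theorem iSup_basicOpen_chartSections_eq_top :
    ⨆ i, ⨆ a, Z.basicOpen ((chartSections ι).coeff i a) = ⊤ := by
  refine top_le_iff.mp ?_
  rw [← iSup_Zop_singleton_eq_top ι]
  refine iSup_mono fun i => ?_
  refine le_trans ?_ (le_iSup (fun a => Z.basicOpen ((chartSections ι).coeff i a)) i)
  rw [chartSections_coeff, basicOpen_chartFun, inf_idem]

/-- The opens of the chart datum are the standard charts: `⋃_a Z_{x_i/x_a} = Z_i`. [cite: Hartshorne1977, II Thm. 7.1 (a) (p. 150)] -/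
theorem ofCocycleSections_chartSections_U (hcov : ⨆ i, ⨆ a, Z.basicOpen ((chartSections ι).coeff i a) = ⊤) (i : Fin (r + 1)) :
    (ofCocycleSections _ (chartSections ι) hcov).U i = Zop ι {i} := by
  rw [ofCocycleSections_U]
  refine le_antisymm (iSup_le fun a => ?_) ?_
  · rw [chartSections_coeff, basicOpen_chartFun]; exact inf_le_right
  · refine le_trans ?_ (le_iSup (fun a => Z.basicOpen ((chartSections ι).coeff i a)) i)
    rw [chartSections_coeff, basicOpen_chartFun, inf_idem]

/-- **The chart datum of the homogeneous coordinates IS `GeneratingSections.ofHom ι`** (same opens `Z_i = ι⁻¹D₊(x_i)`, same ratios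
`x_j/x_i = ι^*(x_j/x_i)`; ★ `GeneratingSections.eq_of_U_eq`). [cite: Hartshorne1977, II Thm. 7.1 (a) (p. 150)] -/
theorem ofCocycleSections_chartSections_eq_ofHom (hcov : ⨆ i, ⨆ a, Z.basicOpen ((chartSections ι).coeff i a) = ⊤) :
    ofCocycleSections _ (chartSections ι) hcov = ofHom ι := by
  have hU : ∀ i, (ofCocycleSections _ (chartSections ι) hcov).U i = (ofHom ι).U i := fun i => by
    rw [ofCocycleSections_chartSections_U, ofHom_U]; exact Zop_singleton_eq_preU ι i
  refine eq_of_U_eq hU fun i j => ?_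
  symm
  refine ofCocycleSections_ratio_unique _ (chartSections ι) hcov i j _ fun a => ?_
  -- on `Z_{x_i/x_a} = Z_a ∩ Z_i`: `ι^*(x_j/x_i) · (x_i/x_a) = x_j/x_a`
  have hVa : Z.basicOpen ((chartSections ι).coeff i a) ≤ Zop ι {a} := Z.basicOpen_le _
  have hVi : Z.basicOpen ((chartSections ι).coeff i a) ≤ Zop ι {i} := by
    rw [chartSections_coeff, basicOpen_chartFun]; exact inf_le_right
  have h1 : Z.presheaf.map (homOfLE (basicOpen_le_ofCocycleSections_U _ (chartSections ι) hcov i a)).op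
      (Z.presheaf.map (eqToHom (hU i)).op ((ofHom ι).ratio i j)) =
      Z.presheaf.map (homOfLE hVi).op (chartFun ι j i) := by
    rw [ofHom_ratio, res_res, chartFun_eq_map_homRatio, res_res]
    exact congrArg (fun φ => Z.presheaf.map φ (homRatio ι i j)) (Subsingleton.elim _ _)
  rw [h1]
  change Z.presheaf.map (homOfLE hVi).op (chartFun ι j i) * Z.presheaf.map (homOfLE hVa).op (chartFun ι i a) =
    Z.presheaf.map (homOfLE hVa).op (chartFun ι j a)
  rw [chartFun_cocycle ι j a i hVa hVi]

/-- **Hartshorne II 7.1 for the chart datum**: the morphism to `𝐏ʳ_A` defined by the homogeneous coordinates of an embedded scheme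
is the embedding (★ `toProj_ofHom`). [cite: Hartshorne1977, II Thm. 7.1 (b) (p. 150)] -/
theorem toProj_chartSections (hcov : ⨆ i, ⨆ a, Z.basicOpen ((chartSections ι).coeff i a) = ⊤) :
    (ofCocycleSections _ (chartSections ι) hcov).toProj (strZ ι) = ι := by
  rw [ofCocycleSections_chartSections_eq_ofHom]
  exact toProj_ofHom (strZ ι) ι rfl

/-! ## §2 The frame datum of `(𝒪_Z(1), (x_i|_Z))` equals the chart datum -/

/-- Restrictions of `𝒪_Z` along parallel arrows agree. [folklore] -/
private theorem res_congr {U V : Z.Opens} (p q : op U ⟶ op V) (s : Γ(Z, U)) :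
    Z.presheaf.map p s = Z.presheaf.map q s := by rw [Subsingleton.elim p q]

/-- **`x_i|_{Z_a} = (x_i/x_a) · x_a|_{Z_a}`** in `Γ(Z_a, 𝒪_Z(1))` (chart by chart: `x_i/x_j = (x_i/x_a)(x_a/x_j)`, ★ `chartFun_cocycle`).
[cite: Hartshorne1977, II Prop. 5.12 (p. 117)] -/
theorem map_monomialSection_one_eq_chartFun_smul (i a : Fin (r + 1)) :
    (twistMod ι (unitModule Z) 1).presheaf.map (homOfLE (le_top : Zop ι {a} ≤ ⊤)).op
        (monomialSection ι 1 (fun _ : Fin 1 => i)) =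
      chartFun ι i a • (twistMod ι (unitModule Z) 1).presheaf.map (homOfLE (le_top : Zop ι {a} ≤ ⊤)).op
        (monomialSection ι 1 (fun _ : Fin 1 => a)) := by
  apply twistMod_ext
  intro j
  rw [comp_map, comp_smul, comp_map]
  change Z.presheaf.map _ (show Γ(Z, ⊤ ⊓ Zop ι {j}) from comp ι (unitModule Z) (monomialSection ι 1 (fun _ : Fin 1 => i)) j) =
    Z.presheaf.map _ (chartFun ι i a) *
      Z.presheaf.map _ (show Γ(Z, ⊤ ⊓ Zop ι {j}) from comp ι (unitModule Z) (monomialSection ι 1 (fun _ : Fin 1 => a)) j)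
  rw [comp_monomialSection_eq_map_wordFun, comp_monomialSection_eq_map_wordFun, wordFun_const', wordFun_const', pow_one,
    pow_one, res_res, res_res]
  have hc := chartFun_cocycle ι i j a (V := Zop ι {a} ⊓ Zop ι {j}) inf_le_right inf_le_left
  rw [res_congr _ (homOfLE (inf_le_right : Zop ι {a} ⊓ Zop ι {j} ≤ Zop ι {j})).op (chartFun ι i j), hc,
    res_congr _ (homOfLE (inf_le_left : Zop ι {a} ⊓ Zop ι {j} ≤ Zop ι {a})).op (chartFun ι i a),
    res_congr ((homOfLE _).op ≫ (homOfLE _).op) (homOfLE (inf_le_right : Zop ι {a} ⊓ Zop ι {j} ≤ Zop ι {j})).op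
      (chartFun ι a j)]

/-- **`x_a|_Z` generates `𝒪_Z(1)` on `Z_a`**: every section `n` over `V ⊆ Z_a` is `n_a · x_a|_V`, where `n_a ∈ Γ(V, 𝒪_Z)` is its
`a`-th chart piece (the chart trivialisation ★ `chartEquiv` read backwards). [cite: Hartshorne1977, II Prop. 5.12 (p. 117)] -/
theorem eq_comp_smul_monomialSection {a : Fin (r + 1)} {V : Z.Opens} (hV : V ≤ Zop ι {a})
    (n : Γ(twistMod ι (unitModule Z) 1, V)) :
    n = Z.presheaf.map (homOfLE (le_inf le_rfl hV : V ≤ V ⊓ Zop ι {a})).op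
        (show Γ(Z, V ⊓ Zop ι {a}) from comp ι (unitModule Z) n a) •
      (twistMod ι (unitModule Z) 1).presheaf.map (homOfLE (le_top : V ≤ ⊤)).op (monomialSection ι 1 (fun _ : Fin 1 => a)) := by
  apply twistMod_ext
  intro j
  have ht := (isTwistFamily_comp (ι := ι) (N := unitModule Z) n) j a (V := V ⊓ Zop ι {j}) inf_le_left inf_le_right
    (inf_le_left.trans hV)
  have e0 : (homOfLE (le_inf inf_le_left inf_le_right : V ⊓ Zop ι {j} ≤ V ⊓ Zop ι {j})).op = 𝟙 _ := Subsingleton.elim _ _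
  rw [e0, CategoryTheory.Functor.map_id, CategoryTheory.id_apply, pow_one] at ht
  rw [ht, comp_smul, comp_map]
  change Z.presheaf.map _ (chartFun ι a j) * Z.presheaf.map _ (show Γ(Z, V ⊓ Zop ι {a}) from comp ι (unitModule Z) n a) =
    Z.presheaf.map _ (Z.presheaf.map _ (show Γ(Z, V ⊓ Zop ι {a}) from comp ι (unitModule Z) n a)) *
      Z.presheaf.map _ (show Γ(Z, ⊤ ⊓ Zop ι {j}) from comp ι (unitModule Z) (monomialSection ι 1 (fun _ : Fin 1 => a)) j)
  rw [comp_monomialSection_eq_map_wordFun, wordFun_const', pow_one, res_res, res_res, mul_comm]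
  congr 1

section Frame

variable (F : FrameSystem (twistMod ι (unitModule Z) 1)) (h1 : ∀ x, F.rank x = 1)

/-- **Change of trivialisation**: on `U_x ∩ Z_a` the coefficient of `x_i|_Z` in the local frame at `x` is the coefficient of `x_a|_Z`
times `x_i/x_a` (from `x_i = (x_i/x_a) · x_a` and the `𝒪`-linearity of coordinates, ★ `coord_smul`).
[cite: Hartshorne1977, II proof of Thm. 7.1 (p. 150)] -/
theorem map_coeffAt_monomialSection_eq_mul (i : Fin (r + 1)) (x : Z) (a : Fin (r + 1)) :
    Z.presheaf.map (homOfLE (inf_le_left : F.U x ⊓ Zop ι {a} ≤ F.U x)).op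
        (coeffAt F h1 (fun i : Fin (r + 1) => monomialSection ι 1 (fun _ : Fin 1 => i)) i x) =
      Z.presheaf.map (homOfLE (inf_le_left : F.U x ⊓ Zop ι {a} ≤ F.U x)).op
          (coeffAt F h1 (fun i : Fin (r + 1) => monomialSection ι 1 (fun _ : Fin 1 => i)) a x) *
        Z.presheaf.map (homOfLE (inf_le_right : F.U x ⊓ Zop ι {a} ≤ Zop ι {a})).op (chartFun ι i a) := by
  rw [map_coeffAt, map_coeffAt]
  have e : (twistMod ι (unitModule Z) 1).presheaf.map (homOfLE (le_top : F.U x ⊓ Zop ι {a} ≤ ⊤)).op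
      (monomialSection ι 1 (fun _ : Fin 1 => i)) =
      Z.presheaf.map (homOfLE (inf_le_right : F.U x ⊓ Zop ι {a} ≤ Zop ι {a})).op (chartFun ι i a) •
        (twistMod ι (unitModule Z) 1).presheaf.map (homOfLE (le_top : F.U x ⊓ Zop ι {a} ≤ ⊤)).op
          (monomialSection ι 1 (fun _ : Fin 1 => a)) := by
    rw [← moduleMap_map_apply (twistMod ι (unitModule Z) 1) (le_top : Zop ι {a} ≤ ⊤)
        (inf_le_right : F.U x ⊓ Zop ι {a} ≤ Zop ι {a}), map_monomialSection_one_eq_chartFun_smul,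
      Scheme.Modules.map_smul, moduleMap_map_apply]
  rw [e, coord_smul, mul_comm]

/-- **The coefficient of `x_a|_Z` in any local frame is a UNIT on `U_x ∩ Z_a`** (both `x_a|_Z` and the frame generator generate
`𝒪_Z(1)` there). [cite: Hartshorne1977, II proof of Thm. 7.1 (p. 150)] -/
theorem isUnit_map_coeffAt_monomialSection (x : Z) (a : Fin (r + 1)) :
    IsUnit (Z.presheaf.map (homOfLE (inf_le_left : F.U x ⊓ Zop ι {a} ≤ F.U x)).op
      (coeffAt F h1 (fun i : Fin (r + 1) => monomialSection ι 1 (fun _ : Fin 1 => i)) a x)) := by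
  set V : Z.Opens := F.U x ⊓ Zop ι {a} with hVdef
  set u : Γ(Z, V) := Z.presheaf.map (homOfLE (inf_le_left : V ≤ F.U x)).op
      (coeffAt F h1 (fun i : Fin (r + 1) => monomialSection ι 1 (fun _ : Fin 1 => i)) a x) with hu
  set bV : Γ(twistMod ι (unitModule Z) 1, V) := (twistMod ι (unitModule Z) 1).presheaf.map
      (homOfLE (inf_le_left : V ≤ F.U x)).op (basisSection (F.frame x) (F.idx h1 x)) with hbV
  set sV : Γ(twistMod ι (unitModule Z) 1, V) := (twistMod ι (unitModule Z) 1).presheaf.map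
      (homOfLE (le_top : V ≤ ⊤)).op (monomialSection ι 1 (fun _ : Fin 1 => a)) with hsV
  -- `x_a|_V = u · b|_V` and `b|_V = d · x_a|_V`
  have hs : sV = u • bV :=
    map_top_eq_map_coeffAt_smul F h1 (fun i : Fin (r + 1) => monomialSection ι 1 (fun _ : Fin 1 => i)) a x
      (inf_le_left : V ≤ F.U x)
  set d : Γ(Z, V) := Z.presheaf.map (homOfLE (le_inf le_rfl (inf_le_right : V ≤ Zop ι {a}))).op
      (show Γ(Z, V ⊓ Zop ι {a}) from comp ι (unitModule Z) bV a) with hd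
  have hb : bV = d • sV := eq_comp_smul_monomialSection ι (inf_le_right : V ≤ Zop ι {a}) bV
  have hss : sV = (u * d) • sV := by
    conv_lhs => rw [hs, hb, smul_smul]
  -- read the `a`-th chart piece: `x_a / x_a = 1`
  have hc := congrArg (fun n => (show Γ(Z, V ⊓ Zop ι {a}) from comp ι (unitModule Z) n a)) hss
  simp only at hc
  rw [comp_smul] at hc
  change (show Γ(Z, V ⊓ Zop ι {a}) from comp ι (unitModule Z) sV a) =
    Z.presheaf.map _ (u * d) * (show Γ(Z, V ⊓ Zop ι {a}) from comp ι (unitModule Z) sV a) at hc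
  have h1' : (show Γ(Z, V ⊓ Zop ι {a}) from comp ι (unitModule Z) sV a) = 1 := by
    rw [hsV, comp_map]
    change Z.presheaf.map _ (show Γ(Z, ⊤ ⊓ Zop ι {a}) from comp ι (unitModule Z) (monomialSection ι 1 _) a) = 1
    rw [comp_monomialSection_eq_map_wordFun, wordFun_const', chartFun_self, one_pow, map_one, map_one]
  rw [h1', mul_one] at hc
  -- transport `(u d)|_{V ∩ Z_a} = 1` back to `V = V ∩ Z_a`
  have hud : u * d = 1 := by
    have := congrArg (Z.presheaf.map (homOfLE (le_inf le_rfl (inf_le_right : V ≤ Zop ι {a}))).op) hc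
    rw [map_one, res_res] at this
    have e : ∀ (p : op V ⟶ op V), Z.presheaf.map p (u * d) = u * d := fun p => by
      rw [res_congr p (𝟙 _) (u * d), CategoryTheory.Functor.map_id]; rfl
    rw [e] at this
    exact this.symm
  exact ⟨⟨u, d, hud, (mul_comm d u).trans hud⟩, rfl⟩

/-- The trivialising opens of a frame system cover. [folklore] -/
private theorem iSup_frameSystem_U_eq_top : ⨆ x, F.U x = ⊤ :=
  eq_top_iff.mpr fun x _ => Opens.mem_iSup.mpr ⟨x, F.mem x⟩

/-- The non-vanishing loci of the coefficients of the `x_i|_Z` in any frame system cover `Z`. [cite: Hartshorne1977, II Thm. 7.1 (a) (p. 150)] -/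
theorem iSup_basicOpen_coeffAt_monomialSection_eq_top :
    ⨆ i, ⨆ x, Z.basicOpen
      ((CocycleSections.ofFrameSystem F h1 (fun i : Fin (r + 1) => monomialSection ι 1 (fun _ : Fin 1 => i))).coeff i x) = ⊤ := by
  refine eq_top_iff.mpr fun z _ => ?_
  have hz : z ∈ (⨆ a : Fin (r + 1), Zop ι {a}) := by rw [iSup_Zop_singleton_eq_top]; trivial
  obtain ⟨a, ha⟩ := Opens.mem_iSup.mp hz
  have key := basicOpen_coeff_inf_eq_of_rescale
    (CocycleSections.ofFrameSystem F h1 (fun i : Fin (r + 1) => monomialSection ι 1 (fun _ : Fin 1 => i)))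
    (chartSections ι)
    (fun x a => Z.presheaf.map (homOfLE (inf_le_left : F.U x ⊓ Zop ι {a} ≤ F.U x)).op
      (coeffAt F h1 (fun i : Fin (r + 1) => monomialSection ι 1 (fun _ : Fin 1 => i)) a x))
    (fun x a => isUnit_map_coeffAt_monomialSection ι F h1 x a)
    (fun i x a => map_coeffAt_monomialSection_eq_mul ι F h1 i x a) a z a
  have hmem : z ∈ (F.U z ⊓ Zop ι {a}) ⊓ Z.basicOpen ((chartSections ι).coeff a a) := by
    refine ⟨⟨F.mem z, ha⟩, ?_⟩
    rw [chartSections_coeff, basicOpen_chartFun, inf_idem]; exact ha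
  rw [← key] at hmem
  exact Opens.mem_iSup.mpr ⟨a, Opens.mem_iSup.mpr ⟨z, hmem.2⟩⟩

/-- **The frame datum of `(𝒪_Z(1), (x_i|_Z))` IS the chart datum**, for ANY rank-one frame system `F` (★
`ofCocycleSections_eq_of_rescale` with the units `coeffAt(x_a)|_{U_x ∩ Z_a}`). [cite: Hartshorne1977, II Thm. 7.1 (p. 150)] -/
theorem ofCocycleSections_ofFrameSystem_monomialSection_eq
    (hcov : ⨆ i, ⨆ x, Z.basicOpen
      ((CocycleSections.ofFrameSystem F h1 (fun i : Fin (r + 1) => monomialSection ι 1 (fun _ : Fin 1 => i))).coeff i x) = ⊤)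
    (hcov' : ⨆ i, ⨆ a, Z.basicOpen ((chartSections ι).coeff i a) = ⊤) :
    ofCocycleSections F.U (CocycleSections.ofFrameSystem F h1 (fun i : Fin (r + 1) => monomialSection ι 1 (fun _ : Fin 1 => i)))
        hcov = ofCocycleSections _ (chartSections ι) hcov' :=
  ofCocycleSections_eq_of_rescale _ _ (iSup_Zop_singleton_eq_top ι)
    (fun x a => Z.presheaf.map (homOfLE (inf_le_left : F.U x ⊓ Zop ι {a} ≤ F.U x)).op
      (coeffAt F h1 (fun i : Fin (r + 1) => monomialSection ι 1 (fun _ : Fin 1 => i)) a x))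
    (fun x a => isUnit_map_coeffAt_monomialSection ι F h1 x a)
    (fun i x a => map_coeffAt_monomialSection_eq_mul ι F h1 i x a) (iSup_frameSystem_U_eq_top ι F) hcov hcov'

/-- **HEAD (L1). The morphism to `𝐏ʳ_A` defined by `𝒪_Z(1) = twistMod ι 𝒪_Z 1` and its coordinate sections `x_i|_Z`, read in ANY
rank-one frame system, is `ι` itself** ([Hartshorne1977] II Thm. 7.1 (a)+(b): `φ^*𝒪(1)` with `s_i = φ^*x_i` recovers `φ`).
[cite: Hartshorne1977, II Thm. 7.1 (p. 150)] [cite: MumfordFogartyKirwan1994, Ch. 7 §2 Def. 7.5 (p. 130)] -/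
theorem toProj_ofFrameSystem_monomialSection_one :
    ∃ hcov, (ofCocycleSections F.U
      (CocycleSections.ofFrameSystem F h1 (fun i : Fin (r + 1) => monomialSection ι 1 (fun _ : Fin 1 => i))) hcov).toProj
        (strZ ι) = ι :=
  ⟨iSup_basicOpen_coeffAt_monomialSection_eq_top ι F h1, by
    rw [ofCocycleSections_ofFrameSystem_monomialSection_eq ι F h1 _ (iSup_basicOpen_chartSections_eq_top ι),
      toProj_chartSections]⟩

end Frame

section IntProjectiveSpace

variable {J : Type u} (ι₀ : Z ⟶ PP intU.{u} (Nat.card J))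
  (F : FrameSystem (twistMod ι₀ (unitModule Z) 1)) (h1 : ∀ x, F.rank x = 1)

/-- **The `𝐏ⁿ_ℤ`-letter of (L1)** (the shape ★ `PolarizedAbelianSchemeWithLevel.IsFrameRigidification` ends in; note
`Morphisms.projectiveSpaceInt J` unfolds to `ProjCech.PP intU (Nat.card J)`, so a morphism `Z ⟶ projectiveSpaceInt J` may be passed as
`ι₀`): the `S`-point of `𝐏(J; S)` defined by `𝒪_Z(1)` and its coordinate sections in any rank-one frame system (★
`projectiveSpace.pointOfSections`) has `𝐏ⁿ_ℤ`-component `ι₀` (★ `homEquiv_pointOfSections` + the head).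
[cite: Hartshorne1977, II Thm. 7.1 (p. 150)] [cite: MumfordFogartyKirwan1994, Ch. 7 §2 Def. 7.5 (p. 130)] -/
theorem homEquiv_pointOfSections_ofFrameSystem_monomialSection_one {S : Scheme.{u}} (q : Z ⟶ S) :
    ∃ hcov, Morphisms.projectiveSpace.homEquiv (ι := J) (Over.mk q)
        (Morphisms.projectiveSpace.pointOfSections (Over.mk q)
          (ofCocycleSections F.U (CocycleSections.ofFrameSystem F h1 (fun i : Fin (Nat.card J + 1) =>
            monomialSection ι₀ 1 (fun _ : Fin 1 => i))) hcov)) = ι₀ := by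
  obtain ⟨hcov, h⟩ := toProj_ofFrameSystem_monomialSection_one ι₀ F h1
  refine ⟨hcov, ?_⟩
  rw [Morphisms.projectiveSpace.homEquiv_pointOfSections]
  change (ofCocycleSections F.U (CocycleSections.ofFrameSystem F h1 (fun i : Fin (Nat.card J + 1) =>
      monomialSection ι₀ 1 (fun _ : Fin 1 => i))) hcov).toProj (AlgebraicGeometry.specULiftZIsTerminal.from Z) = ι₀
  rw [show AlgebraicGeometry.specULiftZIsTerminal.from Z = strZ ι₀ from
    AlgebraicGeometry.specULiftZIsTerminal.hom_ext _ _]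
  exact h

end IntProjectiveSpace

end SerreTwist

end Literature.AlgebraicGeometry.Modules

end
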